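import Mathlib
import Summits.Ventures.HodgeRepro.Tier4.Common.AdelicDefs
import Summits.Ventures.HodgeRepro.Tier4.Line1.PlaneDefs
import Summits.Ventures.HodgeRepro.Tier4.Line1.C7Components
import Summits.Ventures.HodgeRepro.Tier4.Line1.C7Reconstruct
import Summits.Ventures.HodgeRepro.Tier4.Line1.RationalRotation

/-!
# Tier4/Line1/C7IntegralWitt — C7.2 (integral transitivity at almost all places) modulo INTEGRAL WITT, displayed

Blind re-derivation cell `pub-hodge-repro`, Tier 4 (README §9–§10), seat t4-L1-p2 (prover, LINE L1, gen 2).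
The third wall of t4-L1-p4's C7 census (`proofs/t4/L1/C7-rungs-sig.lean` L139–L147, C7.2: outside a finite set `S₀`
of finite places, `U(W)(𝓞_v)` moves `v₀` to every integral vector of its sphere) in t4-L1-p1's cut (S13090):
* C7.2b (this file, section `PlacesFinite`): a rational element is integral at almost all places and, when non-zero,
  a unit at almost all places — Mathlib's finiteness of the support `{v | 1 < v(a)}` of an element of the fraction
  field of a Dedekind domain (`IsDedekindDomain.HeightOneSpectrum.Support.finite`), applied to `a` and `a⁻¹`;
* C7.2c (section `IntegralWitt`): the instantiation at `k_v` / `𝓞_v` — for `v` outside the finite set `S₀` of places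
  where an entry of `B`, `Ω`, `v₀` is not integral or one of `d`, `det B`, `v₀ B v₀ᵀ`, `2` is not a unit, the data
  `B`, `Ω`, `d`, `v₀` and `v₀ h` lift to `𝓞_v`, the lifted vectors have the same (unit) norm because `h ∈ U(W)(k_v)`,
  and the integral Witt theorem over the local ring `𝓞_v` (C7.2a, t4-L1-p1's `IntegralWitt.lean`, DISPLAYED here
  as the hypothesis `hiw` until it lands — then discharged by name) produces `κ ∈ U(W)(𝓞_v)` with `v₀ κ = v₀ h`.
The conclusion is p4's C7.2 `exists_finset_integral_transitive` VERBATIM (binder `h72` of plan-1's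
`quotient_compact_of_rungs`, Skeleton-v0.29 L677); p4's assembly C7.4 closes C7 from it and C7.1 / C7.1∞.
Junk test: with `hiw` false the theorem is vacuous; with `hiw` true it is C7.2 as typed.  `hiw` is stated at the
specific rings `𝓞_v` (discrete valuation rings, so local) — the shape of C7.2a: `B`, `Ω` over `𝓞_v`, `2`, `d`,
`det B`, `x B xᵀ` units, `x B xᵀ = y B yᵀ` ⟹ an `Ω`-commuting `B`-isometry over `𝓞_v` with `x h = y`.
HC_CM is NOT proved by anyone in this repository.
-/

set_option autoImplicit false

noncomputable section

namespace Summit.Ventures.HodgeRepro.Tier4.Line1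

open NumberField IsDedekindDomain HeightOneSpectrum Topology Common Matrix Filter

section PlacesFinite

variable {k : Type} [Field k] [NumberField k]

/-- (C7.2b) the valuation of a rational element read in the completion `k_v` is its `v`-adic valuation. -/
theorem valued_algebraMap_adicCompletion (v : HeightOneSpectrum (𝓞 k)) (a : k) :
    Valued.v (algebraMap k (v.adicCompletion k) a) = v.valuation k a :=
  valuedAdicCompletion_eq_valuation' v a

/-- (C7.2b) a rational element is integral at almost all finite places (its support is finite). -/
theorem eventually_algebraMap_mem_adicCompletionIntegers (a : k) :
    ∀ᶠ v : HeightOneSpectrum (𝓞 k) in cofinite,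
      algebraMap k (v.adicCompletion k) a ∈ v.adicCompletionIntegers k := by
  rw [eventually_cofinite]
  refine (Support.finite (𝓞 k) a).subset fun v hv => ?_
  simp only [Set.mem_setOf_eq, mem_adicCompletionIntegers, valued_algebraMap_adicCompletion,
    not_le] at hv
  exact hv

/-- (C7.2b) a non-zero rational element has `v`-adic valuation `1` at almost all finite places: its support and
the support of its inverse are finite. -/
theorem eventually_valuation_eq_one {a : k} (ha : a ≠ 0) :
    ∀ᶠ v : HeightOneSpectrum (𝓞 k) in cofinite, v.valuation k a = 1 := by
  have h1 : ∀ᶠ v : HeightOneSpectrum (𝓞 k) in cofinite, v.valuation k a ≤ 1 := by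
    rw [eventually_cofinite]
    refine (Support.finite (𝓞 k) a).subset fun v hv => ?_
    exact not_le.1 hv
  have h2 : ∀ᶠ v : HeightOneSpectrum (𝓞 k) in cofinite, v.valuation k a⁻¹ ≤ 1 := by
    rw [eventually_cofinite]
    refine (Support.finite (𝓞 k) a⁻¹).subset fun v hv => ?_
    exact not_le.1 hv
  filter_upwards [h1, h2] with v hv1 hv2
  rw [map_inv₀] at hv2
  have hne : v.valuation k a ≠ 0 := (map_ne_zero _).2 ha
  exact le_antisymm hv1 ((inv_le_one₀ (zero_lt_iff.2 hne)).1 hv2)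

/-- (C7.2b) a non-zero rational element read in `k_v` has valuation `1` at almost all finite places. -/
theorem eventually_valued_algebraMap_eq_one {a : k} (ha : a ≠ 0) :
    ∀ᶠ v : HeightOneSpectrum (𝓞 k) in cofinite,
      Valued.v (algebraMap k (v.adicCompletion k) a) = 1 := by
  filter_upwards [eventually_valuation_eq_one ha] with v hv
  rw [valued_algebraMap_adicCompletion]
  exact hv

/-- (C7.2b) an element of `𝓞_v` of valuation `1` is a unit of `𝓞_v`. -/
theorem isUnit_of_valued_eq_one (v : HeightOneSpectrum (𝓞 k)) {r : v.adicCompletionIntegers k}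
    (hr : Valued.v (r : v.adicCompletion k) = 1) : IsUnit r :=
  adicCompletionIntegers.isUnit_iff_valued_eq_one.2 hr

end PlacesFinite

section IntegralWitt

/-- `Matrix.map` along a ring homomorphism of the scalar matrix `-(d • 1)`. -/
theorem map_neg_smul_one {R S : Type*} [CommRing R] [CommRing S] (f : R →+* S) (d : R) :
    (-(d • (1 : Matrix (Fin 4) (Fin 4) R))).map f = -(f d • (1 : Matrix (Fin 4) (Fin 4) S)) := by
  ext i j
  by_cases hij : i = j <;> simp [hij]

/-- the row-vector norm `x B xᵀ` is preserved by `h` with `h B hᵀ = B`. -/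
theorem vecMul_dotProduct_vecMul_eq {F : Type*} [CommRing F] {B h : Matrix (Fin 4) (Fin 4) F}
    (hh : h * B * hᵀ = B) (x : Fin 4 → F) :
    (x ᵥ* h) ᵥ* B ⬝ᵥ (x ᵥ* h) = x ᵥ* B ⬝ᵥ x := by
  calc (x ᵥ* h) ᵥ* B ⬝ᵥ (x ᵥ* h) = (x ᵥ* (h * B)) ⬝ᵥ (hᵀ *ᵥ x) := by
        rw [vecMul_vecMul, mulVec_transpose]
    _ = (x ᵥ* (h * B) ᵥ* hᵀ) ⬝ᵥ x := by rw [dotProduct_mulVec]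
    _ = (x ᵥ* (h * B * hᵀ)) ⬝ᵥ x := by rw [vecMul_vecMul]
    _ = x ᵥ* B ⬝ᵥ x := by rw [hh]

variable {k : Type} [Field k] [NumberField k] (W : PlaneData k)

/-- **(C7.2 modulo integral Witt) INTEGRAL TRANSITIVITY AT ALMOST ALL FINITE PLACES**: if the integral Witt theorem
holds over every `𝓞_v` (`hiw`, the shape of C7.2a: for `B`, `Ω`, `d` over `𝓞_v` with `2`, `d`, `det B` units,
`Bᵀ = B`, `Ω² = −d`, `Ω B = −B Ωᵀ`, every two integral vectors of the same unit norm are related by an `Ω`-commuting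
`B`-isometry over `𝓞_v`), then outside a finite set `S₀` of finite places `U(W)(𝓞_v)` moves `v₀` to every integral
vector of its sphere (the conclusion is t4-L1-p4's `exists_finset_integral_transitive`, C7-rungs-sig.lean
L139–L147, verbatim).  `S₀` = the places where an entry of `B`, `Ω` or `v₀` is not integral or one of `d`, `det B`,
`v₀ B v₀ᵀ`, `2` is not a unit (finitely many: C7.2b). -/
theorem exists_finset_integral_transitive_of_integralWitt (hg : IsGenuineRow W) (hW : IsDefinite W)
    (hiw : ∀ (v : HeightOneSpectrum (𝓞 k)) (B Ω : Matrix (Fin 4) (Fin 4) (v.adicCompletionIntegers k))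
      (d : v.adicCompletionIntegers k), IsUnit (2 : v.adicCompletionIntegers k) → Bᵀ = B → IsUnit B.det →
      Ω * Ω = -(d • (1 : Matrix (Fin 4) (Fin 4) (v.adicCompletionIntegers k))) → IsUnit d →
      Ω * B = -(B * Ωᵀ) →
      ∀ x y : Fin 4 → v.adicCompletionIntegers k, IsUnit (x ᵥ* B ⬝ᵥ x) → x ᵥ* B ⬝ᵥ x = y ᵥ* B ⬝ᵥ y →
        ∃ h : Matrix (Fin 4) (Fin 4) (v.adicCompletionIntegers k), h * Ω = Ω * h ∧ h * B * hᵀ = B ∧ x ᵥ* h = y)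
    (v₀ : Fin 4 → k) (hv₀ : v₀ ≠ 0) :
    ∃ S₀ : Finset (HeightOneSpectrum (𝓞 k)), ∀ v ∉ S₀, ∀ h ∈ localU W v,
      (∀ i, (finRat v v₀ ᵥ* h) i ∈ v.adicCompletionIntegers k) →
        ∃ κ ∈ localUInt W v, finRat v v₀ ᵥ* κ = finRat v v₀ ᵥ* h := by
  obtain ⟨⟨d, hΩΩ, hdsq⟩, hrow, -⟩ := hg
  have hd0 : d ≠ 0 := by
    rintro rfl
    exact hdsq ⟨0, by simp⟩
  have hdet : W.B.det ≠ 0 := det_B_ne_zero_of_isDefinite W hW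
  have hα : v₀ ᵥ* W.B ⬝ᵥ v₀ ≠ 0 := by
    have := pair_self_ne_zero_of_isDefinite W hW hv₀
    rwa [dotProduct_mulVec] at this
  -- the finite exceptional set: outside it everything is integral / a unit
  have hev : ∀ᶠ v : HeightOneSpectrum (𝓞 k) in cofinite,
      (∀ i j, algebraMap k (v.adicCompletion k) (W.B i j) ∈ v.adicCompletionIntegers k) ∧
      (∀ i j, algebraMap k (v.adicCompletion k) (W.Ω i j) ∈ v.adicCompletionIntegers k) ∧
      (∀ i, algebraMap k (v.adicCompletion k) (v₀ i) ∈ v.adicCompletionIntegers k) ∧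
      Valued.v (algebraMap k (v.adicCompletion k) d) = 1 ∧
      Valued.v (algebraMap k (v.adicCompletion k) W.B.det) = 1 ∧
      Valued.v (algebraMap k (v.adicCompletion k) (v₀ ᵥ* W.B ⬝ᵥ v₀)) = 1 ∧
      Valued.v (algebraMap k (v.adicCompletion k) 2) = 1 :=
    (eventually_all.2 fun i => eventually_all.2 fun j =>
        eventually_algebraMap_mem_adicCompletionIntegers (W.B i j)).and
      ((eventually_all.2 fun i => eventually_all.2 fun j =>
        eventually_algebraMap_mem_adicCompletionIntegers (W.Ω i j)).and
      ((eventually_all.2 fun i => eventually_algebraMap_mem_adicCompletionIntegers (v₀ i)).and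
      ((eventually_valued_algebraMap_eq_one hd0).and
      ((eventually_valued_algebraMap_eq_one hdet).and
      ((eventually_valued_algebraMap_eq_one hα).and
      (eventually_valued_algebraMap_eq_one (two_ne_zero : (2 : k) ≠ 0)))))))
  refine ⟨(eventually_cofinite.1 hev).toFinset, fun v hv h hh hint => ?_⟩
  have hPv := not_not.1 fun hn => hv ((Set.Finite.mem_toFinset _).2 hn)
  obtain ⟨hBint, hΩint, hv₀int, hdv, hdetv, hαv, h2v⟩ := hPv
  -- the lifts to `𝓞_v`
  let ι : v.adicCompletionIntegers k →+* v.adicCompletion k := (v.adicCompletionIntegers k).subtype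
  let B' : Matrix (Fin 4) (Fin 4) (v.adicCompletionIntegers k) :=
    fun i j => ⟨algebraMap k (v.adicCompletion k) (W.B i j), hBint i j⟩
  let Ω' : Matrix (Fin 4) (Fin 4) (v.adicCompletionIntegers k) :=
    fun i j => ⟨algebraMap k (v.adicCompletion k) (W.Ω i j), hΩint i j⟩
  let d' : v.adicCompletionIntegers k :=
    ⟨algebraMap k (v.adicCompletion k) d, (mem_adicCompletionIntegers (𝓞 k) k v).2 hdv.le⟩
  let x' : Fin 4 → v.adicCompletionIntegers k := fun i => ⟨finRat v v₀ i, hv₀int i⟩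
  let y' : Fin 4 → v.adicCompletionIntegers k := fun i => ⟨(finRat v v₀ ᵥ* h) i, hint i⟩
  have hB'map : B'.map ι = W.B.map (algebraMap k (v.adicCompletion k)) := by ext i j; rfl
  have hΩ'map : Ω'.map ι = W.Ω.map (algebraMap k (v.adicCompletion k)) := by ext i j; rfl
  have hx'map : ι ∘ x' = finRat v v₀ := by funext i; rfl
  have hy'map : ι ∘ y' = finRat v v₀ ᵥ* h := by funext i; rfl
  have hinj : Function.Injective ι := Subtype.val_injective
  have hmapinj : Function.Injective
      (fun M : Matrix (Fin 4) (Fin 4) (v.adicCompletionIntegers k) => M.map ι) :=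
    Matrix.map_injective hinj
  -- the hypotheses of the integral Witt theorem at `v`
  have h2 : IsUnit (2 : v.adicCompletionIntegers k) := by
    apply isUnit_of_valued_eq_one
    rw [map_ofNat] at h2v
    exact h2v
  have hBt : B'ᵀ = B' := by
    apply hmapinj
    simp only
    rw [transpose_map, hB'map, ← transpose_map, W.B_symm]
  have hBdet : IsUnit B'.det := by
    apply isUnit_of_valued_eq_one
    have h1 : (B'.det : v.adicCompletion k) = (W.B.map (algebraMap k (v.adicCompletion k))).det := by
      rw [← hB'map]
      exact RingHom.map_det ι B'
    rw [h1, ← RingHom.mapMatrix_apply, ← RingHom.map_det]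
    exact hdetv
  have hΩΩ' : Ω' * Ω' = -(d' • (1 : Matrix (Fin 4) (Fin 4) (v.adicCompletionIntegers k))) := by
    apply hmapinj
    simp only
    rw [Matrix.map_mul, hΩ'map, ← Matrix.map_mul, hΩΩ, map_neg_smul_one, map_neg_smul_one]
    rfl
  have hd' : IsUnit d' := isUnit_of_valued_eq_one v hdv
  have hrow' : Ω' * B' = -(B' * Ω'ᵀ) := by
    apply hmapinj
    simp only
    rw [Matrix.map_mul, Matrix.map_neg ι (map_neg ι), Matrix.map_mul, transpose_map, hΩ'map, hB'map,
      ← Matrix.map_mul, ← transpose_map, ← Matrix.map_mul, ← Matrix.map_neg _ (map_neg _), hrow]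
  have hφv₀ : (algebraMap k (v.adicCompletion k)) ∘ v₀ = finRat v v₀ := rfl
  have hx'B : ι ∘ (x' ᵥ* B') = finRat v v₀ ᵥ* W.B.map (algebraMap k (v.adicCompletion k)) := by
    funext i
    rw [Function.comp_apply, RingHom.map_vecMul, hx'map, hB'map]
  have hy'B : ι ∘ (y' ᵥ* B') =
      (finRat v v₀ ᵥ* h) ᵥ* W.B.map (algebraMap k (v.adicCompletion k)) := by
    funext i
    rw [Function.comp_apply, RingHom.map_vecMul, hy'map, hB'map]
  have hv₀B : (algebraMap k (v.adicCompletion k)) ∘ (v₀ ᵥ* W.B) =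
      finRat v v₀ ᵥ* W.B.map (algebraMap k (v.adicCompletion k)) := by
    funext i
    rw [Function.comp_apply, RingHom.map_vecMul, hφv₀]
  have hxBx : ((x' ᵥ* B' ⬝ᵥ x' : v.adicCompletionIntegers k) : v.adicCompletion k) =
      algebraMap k (v.adicCompletion k) (v₀ ᵥ* W.B ⬝ᵥ v₀) := by
    change ι (x' ᵥ* B' ⬝ᵥ x') = _
    rw [RingHom.map_dotProduct, RingHom.map_dotProduct, hx'map, hx'B, hv₀B, hφv₀]
  have hyBy : ((y' ᵥ* B' ⬝ᵥ y' : v.adicCompletionIntegers k) : v.adicCompletion k) =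
      ((finRat v v₀ ᵥ* h) ᵥ* W.B.map (algebraMap k (v.adicCompletion k))) ⬝ᵥ (finRat v v₀ ᵥ* h) := by
    change ι (y' ᵥ* B' ⬝ᵥ y') = _
    rw [RingHom.map_dotProduct, hy'map, hy'B]
  have hxunit : IsUnit (x' ᵥ* B' ⬝ᵥ x') := by
    apply isUnit_of_valued_eq_one
    rw [hxBx]
    exact hαv
  have hxy : x' ᵥ* B' ⬝ᵥ x' = y' ᵥ* B' ⬝ᵥ y' := by
    apply hinj
    change ((x' ᵥ* B' ⬝ᵥ x' : v.adicCompletionIntegers k) : v.adicCompletion k) =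
      ((y' ᵥ* B' ⬝ᵥ y' : v.adicCompletionIntegers k) : v.adicCompletion k)
    rw [hyBy, vecMul_dotProduct_vecMul_eq hh.2, hxBx, RingHom.map_dotProduct, hv₀B, hφv₀]
  obtain ⟨κ', hκΩ, hκB, hκx⟩ := hiw v B' Ω' d' h2 hBt hBdet hΩΩ' hd' hrow' x' y' hxunit hxy
  refine ⟨κ'.map ι, ⟨⟨?_, ?_⟩, fun i j => (κ' i j).2⟩, ?_⟩
  · rw [← hΩ'map, ← Matrix.map_mul, ← Matrix.map_mul, hκΩ]
  · rw [← hB'map, ← Matrix.map_mul, ← transpose_map, ← Matrix.map_mul, hκB]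
  · rw [← hy'map, ← hx'map]
    funext i
    rw [Function.comp_apply, ← RingHom.map_vecMul, hκx]

end IntegralWitt

end Summit.Ventures.HodgeRepro.Tier4.Line1

end
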